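import Summits.CriticalPhenomena.CardyFormulaZ2.Theorems.CardyBoundaryCoulombGasHalfPlaneMarkDensityLawSelfDualityExact
import Summits.CriticalPhenomena.CardyFormulaZ2.Theorems.CardyBoundaryCoulombGasHalfPlaneMarkDensityLawWindowLowerBound
import Summits.CriticalPhenomena.CardyFormulaZ2.Theorems.CardyBoundaryCoulombGasHalfPlaneMarkDensityLawInterleave
import Literature.Probability.Percolation.ClusterBoundary
import Literature.Probability.Percolation.LatticeSymmetry

/-!
# Lead's skeleton (c12-0), cycle 4: **POSITIVITY OF THE LATTICE MARK DENSITY, separation-free**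
# (crux `HalfPlaneMarkDensityLaw`, line `Sketch`; closes the registered stub `stub_densityPositivity`)

`lawSeq a b c x n = n · P[E_n]`, `E_n = firstHit halfPlane A_n ⌊cn⌋ ⌊xn⌋` (`(⌊xn⌋,0)` is the `c`-most
point of `[⌊cn⌋,∞)×{0}` joined inside `H = ℤ×ℕ` to `A_n = [⌊an⌋,⌊bn⌋]×{0}`).  Claim: `liminf_n lawSeq > 0`.

The pinch at `(k,0)` is never split into two arms.  Let `NL(k; lo, hi)` be the event that the NEAREST
bottom point `t < k` of the `H`-cluster of `(k,0)` lies in `[lo, hi]` ("nearest-left neighbour").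
* COUNTING (`stub_nearestLeft_of_window`, `_shift`, `_lowerBound`): on the window event
  `{L(B, c') ∈ [1,w]}` (probability `≥ c₀`, this seat's `Window.stub_windowLowerBound`) the point
  `k* = L(B,c')` satisfies `NL(k*; lo, c'−1)`; the events `NL(k; k−D₂, k−D₁)`, `k ∈ [1,w]`, are lattice
  translates of one another, so the union bound gives `P[NL(k; k−D₂, k−D₁)] ≥ c₀/w ≍ 1/n` — Werner's
  counting for the nearest-neighbour statistic instead of the two-arm event.
* DECOUPLING (`stub_firstHit_of_hCluster`, `stub_hCluster_indep`, `stub_firstHit_decoupling`): condition on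
  the `H`-cluster `S` of `(k,0)` (the full-plane cluster of the configuration restricted to the edges of `H`,
  `Literature…ClusterBoundary`: determined by the edges touching `S`, independent of everything off `S`);
  on `NL(k; ⌊an⌋, ⌊bn⌋)` with cluster `S`, the event `E_n` can only fail through an open path of `H` OFF `S`
  from `(t, ⌊bn⌋]×{0}` to `[⌊cn⌋, k)×{0}` (planarity `TwoArmLower.stub_interleave` excludes sources left
  of `t`), an event of probability `≤ P_n(a,b,c,x) ≤ 1 − c₁` (this seat's `Window.stub_eventually_le_one_sub`);
  summing over `S`: `P[E_n] ≥ c₁ · P[NL(⌊xn⌋; ⌊an⌋, ⌊bn⌋)] ≥ c₁ c₀ / (y' n)`.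
No arm separation, no extendability: the sharp exponent enters only through the exact window identity.
-/

noncomputable section

namespace Summit.CriticalPhenomena.CardyFormulaZ2.Cruxes.HalfPlaneMarkDensityLaw.SketchLine

open Literature.Probability.Percolation Literature.Probability.LatticeModels
open MeasureTheory Filter Set SimpleGraph
open scoped Topology
open Summit.CriticalPhenomena.CardyFormulaZ2.Theorems.HalfPlaneMarkDensityLaw.Negative

namespace Positivity

/-- STUB Q1 (deterministic counting inclusion): on the window event `{L(B,c') ∈ [1,w]}` the leftmost point `k` of `[c',w]` joined to `B = [lo,hi]×{0}` has its nearest-left `H`-cluster neighbour in `[lo, c'−1]`. [folklore] -/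
theorem stub_nearestLeft_of_window :
    ∀ (ω : BondConfig (Site 2)) (lo hi c' w : ℤ), hi < c' →
      ω ∈ openCrossing halfPlane (rowIcc lo hi) (rowIcc c' w) \ openCrossing halfPlane (rowIcc lo hi) (rowIcc c' 0) →
      ∃ k : ℤ, 1 ≤ k ∧ k ≤ w ∧
        ω ∈ {ω : BondConfig (Site 2) | ∃ t : ℤ, lo ≤ t ∧ t ≤ c' - 1 ∧ ω ∈ openConnIn halfPlane (bpt (k)) (bpt t) ∧ ∀ s : ℤ, t < s → s < k → ω ∉ openConnIn halfPlane (bpt (k)) (bpt s)} := by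
  sorry

/-- STUB Q2 (translation invariance of the nearest-left event). [folklore] -/
theorem stub_nearestLeft_shift :
    ∀ (k lo hi : ℤ),
      μ.real {ω : BondConfig (Site 2) | ∃ t : ℤ, lo + k ≤ t ∧ t ≤ hi + k ∧ ω ∈ openConnIn halfPlane (bpt (k)) (bpt t) ∧ ∀ s : ℤ, t < s → s < k → ω ∉ openConnIn halfPlane (bpt (k)) (bpt s)} =
      μ.real {ω : BondConfig (Site 2) | ∃ t : ℤ, lo ≤ t ∧ t ≤ hi ∧ ω ∈ openConnIn halfPlane (bpt (0)) (bpt t) ∧ ∀ s : ℤ, t < s → s < 0 → ω ∉ openConnIn halfPlane (bpt (0)) (bpt s)} := by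
  sorry

/-- STUB Q3: **`n · P[NL(⌊xn⌋; ⌊an⌋, ⌊bn⌋)] ≥ c₀ > 0` eventually** (`a < b < x`). [folklore] -/
theorem stub_nearestLeft_lowerBound :
    ∀ (a b x : ℝ), a < b → b < x → ∃ c₀ : ℝ, 0 < c₀ ∧ ∀ᶠ n : ℕ in atTop,
      c₀ ≤ (n : ℝ) * μ.real {ω : BondConfig (Site 2) | ∃ t : ℤ, ⌊a * n⌋ ≤ t ∧ t ≤ ⌊b * n⌋ ∧ ω ∈ openConnIn halfPlane (bpt (⌊x * n⌋)) (bpt t) ∧ ∀ s : ℤ, t < s → s < ⌊x * n⌋ → ω ∉ openConnIn halfPlane (bpt (⌊x * n⌋)) (bpt s)} := by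
  sorry

/-- STUB Q4 (deterministic): if the `H`-cluster of `(k,0)` is `S`, with nearest-left bottom point `t ∈ [lo,hi]`, and no open path of `H` off `S` joins `(t,hi]×{0}` to `[cl,k)×{0}`, then `firstHit halfPlane ([lo,hi]×{0}) cl k` holds. [folklore] -/
theorem stub_firstHit_of_hCluster :
    ∀ (ω : BondConfig (Site 2)) (S : Finset (Site 2)) (k t lo hi cl : ℤ), ω ⊆ (zdGraph 2).edgeSet →
      lo ≤ t → t ≤ hi → hi < cl → cl ≤ k → bpt t ∈ S → (∀ s : ℤ, t < s → s < k → bpt s ∉ S) →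
      ω ∈ {ω : BondConfig (Site 2) | openCluster (ω ∩ {e : Sym2 (Site 2) | ∀ v ∈ e, v ∈ halfPlane}) (bpt (k)) = ↑S} →
      ω ∉ (⋃ u ∈ rowIcc (t + 1) hi, ⋃ v ∈ rowIcc cl (k - 1),
          (openConnIn (halfPlane ∩ (↑S : Set (Site 2))ᶜ) u v : Set (BondConfig (Site 2)))) →
      ω ∈ firstHit halfPlane (rowIcc lo hi) cl k := by
  sorry

/-- STUB Q5 (the `H`-cluster): the cluster of `(k,0)` in the configuration restricted to the edges of `H` is the set of sites joined to `(k,0)` inside `H`. [folklore] -/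
theorem stub_mem_hCluster_iff :
    ∀ (ω : BondConfig (Site 2)) (k : ℤ) (v : Site 2),
      v ∈ openCluster (ω ∩ {e : Sym2 (Site 2) | ∀ v ∈ e, v ∈ halfPlane}) (bpt k) ↔ ω ∈ openConnIn halfPlane (bpt k) v := by
  sorry

/-- STUB Q6 (independence): the event "the `H`-cluster of `(k,0)` is `S`" is independent of every measurable event determined by the pairs off `S`. [folklore] -/
theorem stub_hCluster_indep :
    ∀ (k : ℤ) (S : Finset (Site 2)) (B : Set (BondConfig (Site 2))),
      DeterminedBy B ((↑S : Set (Site 2))ᶜ).sym2 → MeasurableSet B →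
      μ.real ({ω : BondConfig (Site 2) | openCluster (ω ∩ {e : Sym2 (Site 2) | ∀ v ∈ e, v ∈ halfPlane}) (bpt (k)) = ↑S} ∩ B) =
        μ.real {ω : BondConfig (Site 2) | openCluster (ω ∩ {e : Sym2 (Site 2) | ∀ v ∈ e, v ∈ halfPlane}) (bpt (k)) = ↑S} * μ.real B := by
  sorry

/-- STUB Q7 (measurability of the `H`-cluster event). [folklore] -/
theorem stub_hCluster_measurable :
    ∀ (k : ℤ) (S : Finset (Site 2)),
      MeasurableSet {ω : BondConfig (Site 2) | openCluster (ω ∩ {e : Sym2 (Site 2) | ∀ v ∈ e, v ∈ halfPlane}) (bpt (k)) = ↑S} := by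
  sorry

/-- STUB Q8 (decoupling): **`(1 − q) · P[NL(k; lo, hi)] ≤ P[firstHit halfPlane ([lo,hi]×{0}) cl k]`** whenever every off-cluster escape crossing has probability `≤ q`. [folklore] -/
theorem stub_firstHit_decoupling :
    ∀ (k lo hi cl : ℤ) (q : ℝ), lo ≤ hi → hi < cl → cl ≤ k →
      (∀ t : ℤ, lo ≤ t → t ≤ hi → μ.real (openCrossing halfPlane (rowIcc (t + 1) hi) (rowIcc cl (k - 1))) ≤ q) →
      (1 - q) * μ.real {ω : BondConfig (Site 2) | ∃ t : ℤ, lo ≤ t ∧ t ≤ hi ∧ ω ∈ openConnIn halfPlane (bpt (k)) (bpt t) ∧ ∀ s : ℤ, t < s → s < k → ω ∉ openConnIn halfPlane (bpt (k)) (bpt s)} ≤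
        μ.real (firstHit halfPlane (rowIcc lo hi) cl k) := by
  sorry

/-- STUB Q9 (target, = registered `stub_densityPositivity`): **`liminf_n n·P[E_n(a,b,c,x)] > 0`.** [folklore] -/
theorem stub_densityPositivity' :
    ∀ (a b c x : ℝ), a < b → b < c → c < x → ∃ c₁ : ℝ, 0 < c₁ ∧ ∀ᶠ n : ℕ in atTop, c₁ ≤ lawSeq a b c x n := by
  sorry

/-! ### Glue forms (all stubs provable in parallel) -/

/-- STUB Q3' (glue): Q1, Q2 and `Window.stub_windowLowerBound` give Q3. [folklore] -/
theorem stub_nearestLeft_lowerBound_of :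
    (∀ (ω : BondConfig (Site 2)) (lo hi c' w : ℤ), hi < c' →
      ω ∈ openCrossing halfPlane (rowIcc lo hi) (rowIcc c' w) \ openCrossing halfPlane (rowIcc lo hi) (rowIcc c' 0) →
      ∃ k : ℤ, 1 ≤ k ∧ k ≤ w ∧
        ω ∈ {ω : BondConfig (Site 2) | ∃ t : ℤ, lo ≤ t ∧ t ≤ c' - 1 ∧ ω ∈ openConnIn halfPlane (bpt (k)) (bpt t) ∧ ∀ s : ℤ, t < s → s < k → ω ∉ openConnIn halfPlane (bpt (k)) (bpt s)}) →
    (∀ (k lo hi : ℤ),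
      μ.real {ω : BondConfig (Site 2) | ∃ t : ℤ, lo + k ≤ t ∧ t ≤ hi + k ∧ ω ∈ openConnIn halfPlane (bpt (k)) (bpt t) ∧ ∀ s : ℤ, t < s → s < k → ω ∉ openConnIn halfPlane (bpt (k)) (bpt s)} =
      μ.real {ω : BondConfig (Site 2) | ∃ t : ℤ, lo ≤ t ∧ t ≤ hi ∧ ω ∈ openConnIn halfPlane (bpt (0)) (bpt t) ∧ ∀ s : ℤ, t < s → s < 0 → ω ∉ openConnIn halfPlane (bpt (0)) (bpt s)}) →
    ∀ (a b x : ℝ), a < b → b < x → ∃ c₀ : ℝ, 0 < c₀ ∧ ∀ᶠ n : ℕ in atTop,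
      c₀ ≤ (n : ℝ) * μ.real {ω : BondConfig (Site 2) | ∃ t : ℤ, ⌊a * n⌋ ≤ t ∧ t ≤ ⌊b * n⌋ ∧ ω ∈ openConnIn halfPlane (bpt (⌊x * n⌋)) (bpt t) ∧ ∀ s : ℤ, t < s → s < ⌊x * n⌋ → ω ∉ openConnIn halfPlane (bpt (⌊x * n⌋)) (bpt s)} := by
  sorry

/-- STUB Q8' (glue): Q4–Q7 give Q8 (sum over the law of the `H`-cluster, `SelfDual.ae_forall_finite_openCluster`). [folklore] -/
theorem stub_firstHit_decoupling_of :
    (∀ (ω : BondConfig (Site 2)) (S : Finset (Site 2)) (k t lo hi cl : ℤ), ω ⊆ (zdGraph 2).edgeSet →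
      lo ≤ t → t ≤ hi → hi < cl → cl ≤ k → bpt t ∈ S → (∀ s : ℤ, t < s → s < k → bpt s ∉ S) →
      ω ∈ {ω : BondConfig (Site 2) | openCluster (ω ∩ {e : Sym2 (Site 2) | ∀ v ∈ e, v ∈ halfPlane}) (bpt (k)) = ↑S} →
      ω ∉ (⋃ u ∈ rowIcc (t + 1) hi, ⋃ v ∈ rowIcc cl (k - 1),
          (openConnIn (halfPlane ∩ (↑S : Set (Site 2))ᶜ) u v : Set (BondConfig (Site 2)))) →
      ω ∈ firstHit halfPlane (rowIcc lo hi) cl k) →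
    (∀ (ω : BondConfig (Site 2)) (k : ℤ) (v : Site 2),
      v ∈ openCluster (ω ∩ {e : Sym2 (Site 2) | ∀ v ∈ e, v ∈ halfPlane}) (bpt k) ↔ ω ∈ openConnIn halfPlane (bpt k) v) →
    (∀ (k : ℤ) (S : Finset (Site 2)) (B : Set (BondConfig (Site 2))),
      DeterminedBy B ((↑S : Set (Site 2))ᶜ).sym2 → MeasurableSet B →
      μ.real ({ω : BondConfig (Site 2) | openCluster (ω ∩ {e : Sym2 (Site 2) | ∀ v ∈ e, v ∈ halfPlane}) (bpt (k)) = ↑S} ∩ B) =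
        μ.real {ω : BondConfig (Site 2) | openCluster (ω ∩ {e : Sym2 (Site 2) | ∀ v ∈ e, v ∈ halfPlane}) (bpt (k)) = ↑S} * μ.real B) →
    (∀ (k : ℤ) (S : Finset (Site 2)),
      MeasurableSet {ω : BondConfig (Site 2) | openCluster (ω ∩ {e : Sym2 (Site 2) | ∀ v ∈ e, v ∈ halfPlane}) (bpt (k)) = ↑S}) →
    ∀ (k lo hi cl : ℤ) (q : ℝ), lo ≤ hi → hi < cl → cl ≤ k →
      (∀ t : ℤ, lo ≤ t → t ≤ hi → μ.real (openCrossing halfPlane (rowIcc (t + 1) hi) (rowIcc cl (k - 1))) ≤ q) →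
      (1 - q) * μ.real {ω : BondConfig (Site 2) | ∃ t : ℤ, lo ≤ t ∧ t ≤ hi ∧ ω ∈ openConnIn halfPlane (bpt (k)) (bpt t) ∧ ∀ s : ℤ, t < s → s < k → ω ∉ openConnIn halfPlane (bpt (k)) (bpt s)} ≤
        μ.real (firstHit halfPlane (rowIcc lo hi) cl k) := by
  sorry

/-- STUB Q9' (glue): Q3, Q8 and `Window.stub_eventually_le_one_sub` give the positivity of the mark density. [folklore] -/
theorem stub_densityPositivity_of :
    (∀ (a b x : ℝ), a < b → b < x → ∃ c₀ : ℝ, 0 < c₀ ∧ ∀ᶠ n : ℕ in atTop,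
      c₀ ≤ (n : ℝ) * μ.real {ω : BondConfig (Site 2) | ∃ t : ℤ, ⌊a * n⌋ ≤ t ∧ t ≤ ⌊b * n⌋ ∧ ω ∈ openConnIn halfPlane (bpt (⌊x * n⌋)) (bpt t) ∧ ∀ s : ℤ, t < s → s < ⌊x * n⌋ → ω ∉ openConnIn halfPlane (bpt (⌊x * n⌋)) (bpt s)}) →
    (∀ (k lo hi cl : ℤ) (q : ℝ), lo ≤ hi → hi < cl → cl ≤ k →
      (∀ t : ℤ, lo ≤ t → t ≤ hi → μ.real (openCrossing halfPlane (rowIcc (t + 1) hi) (rowIcc cl (k - 1))) ≤ q) →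
      (1 - q) * μ.real {ω : BondConfig (Site 2) | ∃ t : ℤ, lo ≤ t ∧ t ≤ hi ∧ ω ∈ openConnIn halfPlane (bpt (k)) (bpt t) ∧ ∀ s : ℤ, t < s → s < k → ω ∉ openConnIn halfPlane (bpt (k)) (bpt s)} ≤
        μ.real (firstHit halfPlane (rowIcc lo hi) cl k)) →
    ∀ (a b c x : ℝ), a < b → b < c → c < x → ∃ c₁ : ℝ, 0 < c₁ ∧ ∀ᶠ n : ℕ in atTop, c₁ ≤ lawSeq a b c x n := by
  sorry

end Positivity

end Summit.CriticalPhenomena.CardyFormulaZ2.Cruxes.HalfPlaneMarkDensityLaw.SketchLine
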